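import Summits.HodgeConjecture.CorCM.AbelianTwoPowerCyclicOverRealQuadratic
import Summits.HodgeConjecture.CorCM.ImaginaryQuadraticCyclicModelTypes
import Literature.AlgebraicGeometry.Pohlmann1968.SimpleDegenerateCMAbelianVarietiesCompositeDimension
import HarnessLib

/-!
# Abelian CM fields of `2`-power degree `≥ 16` cyclic over a quadratic subfield `L`: every simple CM abelian
# variety is nondegenerate IF AND ONLY IF `L` is real — the dichotomy, and Weil-type simple eightfolds in degree `16`

COR-CM (cell `pub-hodgecm2`), binder seat b04 (gen 15), count-neutral claim ABELIAN-2POWER-CLASSIF, part IIIb.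
KERNEL ONLY: theorems; no definition, no named fact, no `sorry`.  `HC_CM` is neither used nor claimed.

Let `K` be a CM field, Galois over `ℚ` with ABELIAN Galois group of order `[K:ℚ] = 2^{n+1} ≥ 16`, and `L ⊆ K` a
quadratic subfield over which `K` is CYCLIC (`Gal(K/ℚ) ≅ ℤ/2^n × ℤ/2` or `ℤ/2^{n+1}`).

* §2 **`exists_isPrimitive_not_isNondegenerate_of_isCyclic_over_imaginary`** — if `L` is IMAGINARY (has a complex
  place), `K` carries a PRIMITIVE DEGENERATE CM type: Dodson's block type (tree, lit-deligne-3: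
  `Pohlmann1968.exists_simple_degenerate_of_gal`, [Dodson1984] §3.2.1 with `σ` a generator of `Gal(K/L)` of order
  `2^n = 2^{n−1}·2`, `2^{n−1} ≥ 4`, and `ρ = c ∉ Gal(K/L)`), of Kubota rank `2^n`.
* §3 **`forall_isNondegenerate_iff_forall_conj_eq`** — THE DICHOTOMY: every primitive CM type of `K` is nondegenerate
  **iff** complex conjugation fixes `L` pointwise (`L` real); `⟸` is part Ib
  (`ThinKernel.isNondegenerate_of_isPrimitive_of_isCyclic_over`).  For `Gal(K/ℚ) ≅ ℤ/2^n × ℤ/2` (`n ≥ 3`) this reads: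
  all simple CM abelian `2^n`-folds with CM by `K` satisfy `Hdg = Div` on all powers iff `c = (2^{n−1}, 0)` (e.g.
  `ℚ(ζ₃₂ − ζ₃₂⁻¹, √3)`), and not if `c = (0, 1)` (`ℚ(ζ₃₂) ⊃ ℚ(i)`) or `c = (2^{n−1}, 1)`.
* §1/§4 — the WEIL-TYPE refinement in degree `16` (kernel-decided model `A = {0,1,2,4} ⊂ ℤ/8`,
  `T₈ = {0}×A ∪ {1}×Aᶜ ⊂ ℤ/2 × ℤ/8`, part IIIa's transfer `ModelType.exists_isPrimitive_weilType_of_model`):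
  **`exists_isPrimitive_weilType_sixteen`** — if `L` is imaginary and `[K:ℚ] = 16` there is a PRIMITIVE CM type of
  WEIL TYPE `(4,4)` over `L`; every abelian variety of this type is a SIMPLE CM EIGHTFOLD carrying an exceptional
  Hodge (Weil) class on the variety ITSELF in the middle degree `H⁸` (`exists_simple_weilType_exceptional_sixteen`,
  Pohlmann's mechanism `exists_exceptional_of_fibres_balanced'`) — Lenstra's example on `ℚ(ζ₃₂) ⊃ ℚ(i)`
  ([Gordon1999HodgeAVSurvey] §9.4.2) for EVERY such field.

## References

* [Dodson1984] B. Dodson, *The structure of Galois groups of CM-fields*, Trans. AMS 283 (1984), §3.2.1.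
* [Gordon1999HodgeAVSurvey] B. B. Gordon, *A survey of the Hodge conjecture for abelian varieties*, 5.13, §9.2,
  §9.4.2, §9.4.3.
* [Kubota1965] T. Kubota, *On the field extension by complex multiplication*, Trans. AMS 118 (1965), §4 Lemma 2.
* [Shimura1998] G. Shimura, *Abelian Varieties with Complex Multiplication and Modular Functions*, §8.2 Prop. 26.
* [Pohlmann1968] H. Pohlmann, *Algebraic cycles on abelian varieties of complex multiplication type*, Ann. of Math.
  88 (1968), Thm. 1, §3.
-/

noncomputable section

open CategoryTheory CategoryTheory.Limits NumberField

namespace Summit.HodgeConjecture.CorCM.ThinKernel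

open Literature.NumberTheory.ComplexMultiplication
open Literature.AlgebraicGeometry.Motives (AbelianVariety CMType)
open Literature.AlgebraicGeometry.HodgeTheory
open Literature.AlgebraicGeometry.ComplexMultiplication (IsCMTypeRealisation isSimple_iff_isPrimitive)
open Literature.Barriers.HodgeConjecture (divisorClassesSpan)
open Literature.AlgebraicGeometry.Pohlmann1968
open Summit.HodgeConjecture.CorCM.GaloisOctic (complexConj_not_mem_fixingSubgroup)
open Summit.HodgeConjecture.CorCM.ModelType (exists_isPrimitive_weilType_of_model)

/-! ## §1 The model `T₈ ⊂ ℤ/2 × ℤ/8` (kernel-decided) -/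

namespace Model8

/-- `T₈ = {0} × {0,1,2,4} ∪ {1} × {3,5,6,7}` is a CM set for `(1,0)`. [folklore] -/
theorem cm : ∀ x : ZMod 2 × ZMod 8,
    x ∈ ({(0,0), (0,1), (0,2), (0,4), (1,3), (1,5), (1,6), (1,7)} : Finset (ZMod 2 × ZMod 8)) ↔
      (1, 0) + x ∉ ({(0,0), (0,1), (0,2), (0,4), (1,3), (1,5), (1,6), (1,7)} : Finset (ZMod 2 × ZMod 8)) := by
  decide

/-- `T₈` has trivial stabiliser (`{0,1,2,4}` is aperiodic and its complement `{3,5,6,7}` is not a translate).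
[folklore] -/
theorem primitive : ∀ v : ZMod 2 × ZMod 8, v ≠ 0 → ∃ w : ZMod 2 × ZMod 8,
    ¬ (w ∈ ({(0,0), (0,1), (0,2), (0,4), (1,3), (1,5), (1,6), (1,7)} : Finset (ZMod 2 × ZMod 8)) ↔
      v + w ∈ ({(0,0), (0,1), (0,2), (0,4), (1,3), (1,5), (1,6), (1,7)} : Finset (ZMod 2 × ZMod 8))) := by
  decide

/-- `T₈` is balanced `(4,4)` over the first coordinate. [folklore] -/
theorem balanced : ∀ b : ZMod 2,
    (Finset.univ.filter fun x : ZMod 2 × ZMod 8 =>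
        x.1 = b ∧ x ∈ ({(0,0), (0,1), (0,2), (0,4), (1,3), (1,5), (1,6), (1,7)} : Finset (ZMod 2 × ZMod 8))).card =
    (Finset.univ.filter fun x : ZMod 2 × ZMod 8 =>
        x.1 = b ∧ x ∉ ({(0,0), (0,1), (0,2), (0,4), (1,3), (1,5), (1,6), (1,7)} : Finset (ZMod 2 × ZMod 8))).card := by
  decide

end Model8

/-! ## §2 `L` imaginary ⟹ a primitive degenerate type (Dodson's block type) -/

section Basic

variable {K : Type} [Field K] [NumberField K] [IsCMField K]

/-- A subfield moved by complex conjugation has a complex place: `φ₀|_L` is not real. [folklore] -/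
theorem conjugate_restrict_ne_of_exists (L : IntermediateField ℚ K) {x : K} (hx : x ∈ L)
    (hcx : IsCMField.complexConj K x ≠ x) (φ₀ : K →+* ℂ) :
    ComplexEmbedding.conjugate (φ₀.comp (algebraMap L K)) ≠ φ₀.comp (algebraMap L K) := by
  intro h
  apply hcx
  apply φ₀.injective
  have hx' := RingHom.congr_fun h ⟨x, hx⟩
  rw [ComplexEmbedding.conjugate_coe_eq, RingHom.comp_apply] at hx'
  change starRingEnd ℂ (φ₀ x) = φ₀ x at hx'
  rw [← hx']
  exact IsCMField.complexEmbedding_complexConj K φ₀ x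

end Basic

section Field

variable {K : Type} [Field K] [NumberField K] [IsCMField K] [IsGalois ℚ K]

omit [IsCMField K] in
/-- The fixing subgroup of an intermediate field `L` with `Gal(K/L)` cyclic is generated by one element `σ` of order
`[K:L]`. [folklore] -/
theorem exists_zpowers_eq_fixingSubgroup (L : IntermediateField ℚ K) (hcyc : IsCyclic (K ≃ₐ[L] K)) :
    ∃ σ : K ≃ₐ[ℚ] K, Subgroup.zpowers σ = L.fixingSubgroup ∧ orderOf σ = Module.finrank L K := by
  haveI : IsCyclic L.fixingSubgroup :=
    isCyclic_of_surjective _ (IntermediateField.fixingSubgroupEquiv L).symm.surjective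
  obtain ⟨z₀, hz₀⟩ := IsCyclic.exists_generator (α := L.fixingSubgroup)
  have hZ : Subgroup.zpowers (z₀ : K ≃ₐ[ℚ] K) = L.fixingSubgroup := by
    refine le_antisymm ((Subgroup.zpowers_le).2 z₀.2) fun x hx => ?_
    obtain ⟨k, hk⟩ := Subgroup.mem_zpowers_iff.1 (hz₀ ⟨x, hx⟩)
    exact Subgroup.mem_zpowers_iff.2 ⟨k, by rw [← Subgroup.coe_zpow, hk]⟩
  refine ⟨z₀, hZ, ?_⟩
  rw [Subgroup.orderOf_coe, orderOf_eq_card_of_forall_mem_zpowers hz₀, IsGalois.card_fixingSubgroup_eq_finrank L]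

/-- **`L` IMAGINARY ⟹ a primitive DEGENERATE type.**  `K` abelian CM of degree `2^{n+1} ≥ 16`, `L` a quadratic
subfield with a complex place over which `K` is cyclic: `K` has a PRIMITIVE CM type of Kubota rank `2^n < 2^n + 1`
— Dodson's block type for `Gal(K/ℚ) = ⟨c⟩ × Gal(K/L)`, `2^n = 2^{n−1}·2` (tree `exists_simple_degenerate_of_gal`).
[cite: Dodson1984, §3.2.1 Theorem] -/
theorem exists_isPrimitive_not_isNondegenerate_of_isCyclic_over_imaginary
    (hcomm : ∀ g h : K ≃ₐ[ℚ] K, g * h = h * g) {n : ℕ} (hK : Module.finrank ℚ K = 2 ^ (n + 1)) (hn : 3 ≤ n)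
    (L : IntermediateField ℚ K) (hL2 : Module.finrank ℚ L = 2) (τ₀ : L →+* ℂ)
    (hτ₀ : ComplexEmbedding.conjugate τ₀ ≠ τ₀) (hcyc : IsCyclic (K ≃ₐ[L] K)) (φ₀ : K →+* ℂ) :
    ∃ Φ : CMType K, IsPrimitive (ℂ ≃+* ℂ) Φ.1 φ₀ ∧ cmTypeRank Φ = 2 ^ n ∧ ¬ IsNondegenerate Φ := by
  obtain ⟨σ, hσZ, hσo⟩ := exists_zpowers_eq_fixingSubgroup L hcyc
  have hKL : Module.finrank L K = 2 ^ n := by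
    have h := Module.finrank_mul_finrank ℚ L K
    rw [hK, hL2, pow_succ, mul_comm] at h
    exact Nat.eq_of_mul_eq_mul_right (by norm_num : 0 < 2) h
  rw [hKL] at hσo
  have hρσ : (IsCMField.complexConj K).restrictScalars ℚ ∉ Subgroup.zpowers σ := by
    rw [hσZ]; exact complexConj_not_mem_fixingSubgroup L τ₀ hτ₀
  have hK' : Module.finrank ℚ K = 2 * 2 ^ n := by rw [hK, pow_succ, mul_comm]
  have hk : 3 ≤ 2 ^ (n - 1) := by
    have : 2 ^ 2 ≤ 2 ^ (n - 1) := Nat.pow_le_pow_right (by norm_num) (by omega)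
    omega
  have hnkl : 2 ^ n = 2 ^ (n - 1) * 2 := by rw [← pow_succ]; congr 1; omega
  obtain ⟨Φ, hprim, hrank, hdeg, -⟩ := exists_simple_degenerate_of_gal hcomm
    (complexConj_restrictScalars_apply φ₀) hσo hρσ hK' hk (le_refl 2) hnkl
  exact ⟨Φ, hprim, by rw [hrank]; omega, hdeg⟩

/-! ## §3 The dichotomy -/

/-- **THE DICHOTOMY.**  Let `K` be a CM field, Galois over `ℚ` with ABELIAN Galois group of order
`[K:ℚ] = 2^{n+1} ≥ 16`, and `L ⊆ K` a quadratic subfield over which `K` is CYCLIC.  Then EVERY PRIMITIVE CM type of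
`K` is NONDEGENERATE (every simple CM abelian `2^n`-fold with CM by `K` has `Hdg = Div` on all powers) **if and only
if complex conjugation fixes `L` pointwise** (`L` is real).  `⟸`: thin kernels (part Ib); `⟹`: for `L` imaginary
Dodson's block type is primitive and degenerate. [cite: Dodson1984, §3.2.1 Theorem] [cite: Kubota1965, §4 Lemma 2]
[cite: Shimura1998, §8.2 Prop. 26] -/
theorem forall_isNondegenerate_iff_forall_conj_eq (hcomm : ∀ g h : K ≃ₐ[ℚ] K, g * h = h * g) {n : ℕ}
    (hK : Module.finrank ℚ K = 2 ^ (n + 1)) (hn : 3 ≤ n) (L : IntermediateField ℚ K)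
    (hL2 : Module.finrank ℚ L = 2) (hcyc : IsCyclic (K ≃ₐ[L] K)) (φ₀ : K →+* ℂ) :
    (∀ Φ : CMType K, IsPrimitive (ℂ ≃+* ℂ) Φ.1 φ₀ → IsNondegenerate Φ) ↔
      ∀ x ∈ L, IsCMField.complexConj K x = x := by
  constructor
  · intro hall
    by_contra hL
    push Not at hL
    obtain ⟨x, hx, hcx⟩ := hL
    obtain ⟨Φ, hprim, -, hdeg⟩ := exists_isPrimitive_not_isNondegenerate_of_isCyclic_over_imaginary hcomm hK hn L
      hL2 (φ₀.comp (algebraMap L K)) (conjugate_restrict_ne_of_exists L hx hcx φ₀) hcyc φ₀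
    exact hdeg (hall Φ hprim)
  · intro hreal Φ hprim
    exact isNondegenerate_of_isPrimitive_of_isCyclic_over hcomm hK L (le_of_eq hL2) hreal hcyc φ₀ hprim

/-- **Simple-variety form of the dichotomy**: (every SIMPLE CM abelian variety `(A, ι, θ)` with CM by `K` — of any
CM type of `K` — realises a nondegenerate type) iff `L` is real. [cite: Dodson1984, §3.2.1 Theorem]
[cite: Shimura1998, §8.2 Prop. 26] -/
theorem forall_isSimple_isNondegenerate_iff_forall_conj_eq (hcomm : ∀ g h : K ≃ₐ[ℚ] K, g * h = h * g) {n : ℕ}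
    (hK : Module.finrank ℚ K = 2 ^ (n + 1)) (hn : 3 ≤ n) (L : IntermediateField ℚ K)
    (hL2 : Module.finrank ℚ L = 2) (hcyc : IsCyclic (K ≃ₐ[L] K)) (φ₀ : K →+* ℂ)
    (hreal : Literature.NumberTheory.Automorphic.PicardCM.CMAbelianVarietyRealised) :
    (∀ (Φ : CMType K) (A : AbelianVariety ℂ) (ι : 𝓞 K →+* End A) (θ : K →+* Module.End ℂ (complexBetti A.X 1)),
        IsCMTypeRealisation Φ A ι θ → A.IsSimple → IsNondegenerate Φ) ↔
      ∀ x ∈ L, IsCMField.complexConj K x = x := by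
  rw [← forall_isNondegenerate_iff_forall_conj_eq hcomm hK hn L hL2 hcyc φ₀]
  constructor
  · intro h Φ hprim
    obtain ⟨A, ι, θ, hA⟩ := hreal K Φ
    exact h Φ A ι θ hA ((isSimple_iff_isPrimitive hA φ₀).2 hprim)
  · intro h Φ A ι θ hA hs
    exact h Φ ((isSimple_iff_isPrimitive hA φ₀).1 hs)

/-! ## §4 Degree `16`: a primitive type of WEIL TYPE over the imaginary quadratic `L` -/

/-- **A SIMPLE CM type of Weil type `(4,4)` over `L`.**  `K` abelian CM of degree `16`, `L` an imaginary quadratic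
subfield with `K/L` cyclic (of order `8`): `K` has a PRIMITIVE CM type under which every embedding of `L` has exactly
`4` extensions inside and `4` outside — the model `T₈` transported by `(b, m) ↦ σ_{c^b g^m}` (part IIIa).  For
`K = ℚ(ζ₃₂) ⊃ ℚ(i)` this is Lenstra's type. [cite: Gordon1999HodgeAVSurvey, §9.4.2] [cite: Shimura1998, §8.2 Prop. 26] -/
theorem exists_isPrimitive_weilType_sixteen (hcomm : ∀ g h : K ≃ₐ[ℚ] K, g * h = h * g)
    (hK : Module.finrank ℚ K = 16) (L : IntermediateField ℚ K) (hL2 : Module.finrank ℚ L = 2) (τ₀ : L →+* ℂ)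
    (hτ₀ : ComplexEmbedding.conjugate τ₀ ≠ τ₀) (hcyc : IsCyclic (K ≃ₐ[L] K)) (φ₀ : K →+* ℂ) :
    ∃ Φ : CMType K, IsPrimitive (ℂ ≃+* ℂ) Φ.1 φ₀ ∧
      ∀ τ : L →+* ℂ, {φ : K →+* ℂ | φ.comp (algebraMap L K) = τ ∧ φ ∈ Φ.1}.ncard =
        {φ : K →+* ℂ | φ.comp (algebraMap L K) = τ ∧ φ ∉ Φ.1}.ncard := by
  have hKL : Module.finrank L K = 8 := by
    have h := Module.finrank_mul_finrank ℚ L K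
    rw [hK, hL2] at h
    omega
  haveI : IsCyclic L.fixingSubgroup :=
    isCyclic_of_surjective _ (IntermediateField.fixingSubgroupEquiv L).symm.surjective
  exact exists_isPrimitive_weilType_of_model hcomm L hL2 hKL τ₀ hτ₀ inferInstance _ Model8.cm Model8.primitive
    Model8.balanced φ₀

variable {A : AbelianVariety ℂ} {ι : 𝓞 K →+* End A} {θ : K →+* Module.End ℂ (complexBetti A.X 1)}

/-- **Simple CM eightfolds of Weil type with a Weil class on the variety itself.**  With `Φ` as in
`exists_isPrimitive_weilType_sixteen`: every abelian variety `(A, ι, θ)` of CM type `(K; Φ)` is SIMPLE and carries,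
in the middle degree `2m = [K:L] = 8`, a rational `(m,m)`-class outside `Dᵐ(A) ⊗ ℂ` (Pohlmann's mechanism for Weil
type over `L`). [cite: Pohlmann1968, Thm. 1 and §3] [cite: Gordon1999HodgeAVSurvey, 5.13 (ii), §9.2, §9.4.2] -/
theorem exists_simple_weilType_exceptional_sixteen (hcomm : ∀ g h : K ≃ₐ[ℚ] K, g * h = h * g)
    (hK : Module.finrank ℚ K = 16) (L : IntermediateField ℚ K) (hL2 : Module.finrank ℚ L = 2) (τ₀ : L →+* ℂ)
    (hτ₀ : ComplexEmbedding.conjugate τ₀ ≠ τ₀) (hcyc : IsCyclic (K ≃ₐ[L] K)) (φ₀ : K →+* ℂ) :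
    ∃ Φ : CMType K, IsPrimitive (ℂ ≃+* ℂ) Φ.1 φ₀ ∧ ¬ IsNondegenerate Φ ∧
      ∀ (A : AbelianVariety ℂ) (ι : 𝓞 K →+* End A) (θ : K →+* Module.End ℂ (complexBetti A.X 1)),
        IsCMTypeRealisation Φ A ι θ → A.IsSimple ∧
          ∃ m : ℕ, ∃ c : complexBetti A.X (2 * m), IsRationalClass c ∧ IsOfHodgeType 8 A.X (2 * m) m m c ∧
            c ∉ divisorClassesSpan A.X 8 m := by
  obtain ⟨Φ, hprim, hW⟩ := exists_isPrimitive_weilType_sixteen hcomm hK L hL2 τ₀ hτ₀ hcyc φ₀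
  refine ⟨Φ, hprim, not_isNondegenerate_of_fibres_balanced (algebraMap L K) hW hτ₀, fun A ι θ hA => ?_⟩
  refine ⟨(isSimple_iff_isPrimitive hA φ₀).2 hprim, ?_⟩
  obtain ⟨m, -, c, hcQ, hcH, hcD⟩ := exists_exceptional_of_fibres_balanced' (algebraMap L K) φ₀ hprim hW hτ₀ hA
  rw [hK] at hcH hcD
  exact ⟨m, c, hcQ, hcH, hcD⟩

end Field

end Summit.HodgeConjecture.CorCM.ThinKernel

end
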